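import Summits.CriticalPhenomena.SAWScalingLimit.Theorems.SAWRenewalTightnessTubeLowerBoundDefs
import Literature.Probability.Percolation.DualContours

/-!
# Crux `TubeLowerBound` (stmt-CriticalPhenomena-4730), line `lieb-simon-star`: helpers for the corner staircase

Lemmas for the stub `stub_cornerStaircase : HalfTubePieceFloor → FirstOctantTubeFloor` (S4b of the checked skeleton
`Cruxes/TubeLowerBound/Lines/lieb-simon-star.lean`, assembled in `SAWRenewalTightnessTubeLowerBoundCornerStaircase.lean`),
all about *tube masses* `∑_{n ≤ N} ∑_ω x_c^n` over the `n`-step self-avoiding walks `ω : 0 → e` whose vertices satisfy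
a confining predicate `P` (the shape of every floor of the line): monotonicity in `P` (`tubeMass_mono`), the trivial
walk (`one_le_tubeMass_zero`), one unit step (`criticalFugacity_le_tubeMass_step`), the coordinate swap
(`tubeMass_swap_le`); the **gluing inequality** `tubeMass_concat` — if the region `P` meets the translate `e₁ + Q`
only where `Q` vanishes, concatenation at `e₁` is a weight-preserving injection into the walks `0 → e₁ + e₂` confined to
any `R ⊇ P ∪ (e₁ + Q)`, self-avoidance being free, so the masses multiply; the two blocks of a staircase round
(`blockH_floor`, `blockV_floor`: a one-sided flat piece of `HalfTubePieceFloor` plus its connector edge, mass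
`≥ x_c · min(c,1) · max(1,L)^{-C}` uniformly in `L ≥ 0`); and the tube test by coordinates (`infDist_segment_le_coord`).
-/

noncomputable section

namespace Summit.CriticalPhenomena.SAWScalingLimit.Theorems.TubeLowerBound.LiebSimonStar

open scoped BigOperators Classical
open Literature.Probability.LatticeModels
open Literature.Probability.RandomPlanarGeometry Literature.Probability.RandomPlanarGeometry.SAW
open Literature.Probability.Percolation.Contour (site_ext)

namespace CornerStaircase

/-! ### Tube masses: monotonicity, the trivial walk, one step, the coordinate swap -/

/-- The tube mass is monotone in the confining predicate. -/
theorem tubeMass_mono {P R : Site 2 → Prop} [DecidablePred P] [DecidablePred R]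
    (hPR : ∀ p, P p → R p) (N : ℕ) (e : Site 2) :
    (∑ n ∈ Finset.range (N + 1),
        ∑ _ω ∈ (Zd.sawFun 2 n e).filter (fun ω => ∀ i ≤ n, P (ω i)), criticalFugacity ^ n) ≤
      ∑ n ∈ Finset.range (N + 1),
        ∑ _ω ∈ (Zd.sawFun 2 n e).filter (fun ω => ∀ i ≤ n, R (ω i)), criticalFugacity ^ n := by
  refine Finset.sum_le_sum fun n _ => Finset.sum_le_sum_of_subset_of_nonneg (fun ω hω => ?_)
    fun _ _ _ => pow_nonneg criticalFugacity_pos.le n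
  rw [Finset.mem_filter] at hω ⊢
  exact ⟨hω.1, fun i hi => hPR _ (hω.2 i hi)⟩

/-- The trivial walk: a family at the origin whose predicate holds at `0` has mass `≥ 1`. -/
theorem one_le_tubeMass_zero {P : Site 2 → Prop} [DecidablePred P] (h0 : P 0) {e : Site 2}
    (he : e = 0) (N : ℕ) :
    (1 : ℝ) ≤ ∑ n ∈ Finset.range (N + 1),
      ∑ _ω ∈ (Zd.sawFun 2 n e).filter (fun ω => ∀ i ≤ n, P (ω i)), criticalFugacity ^ n := by
  subst he
  have hmem : (fun _ : ℕ => (0 : Site 2)) ∈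
      (Zd.sawFun 2 0 0).filter (fun ω => ∀ i ≤ (0 : ℕ), P (ω i)) := by
    rw [Finset.mem_filter]
    refine ⟨Zd.mem_sawFun.2 ⟨rfl, fun _ _ => rfl, fun i hi => absurd hi (Nat.not_lt_zero i), ?_⟩,
      fun _ _ => h0⟩
    intro i hi j hj _
    simp only [Set.mem_setOf_eq, Nat.le_zero] at hi hj
    rw [hi, hj]
  calc (1 : ℝ) = criticalFugacity ^ 0 := (pow_zero _).symm
    _ ≤ ∑ _ω ∈ (Zd.sawFun 2 0 0).filter (fun ω => ∀ i ≤ (0 : ℕ), P (ω i)), criticalFugacity ^ 0 :=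
        Finset.single_le_sum (f := fun _ => criticalFugacity ^ 0) (fun _ _ => zero_le_one) hmem
    _ ≤ _ := Finset.single_le_sum
          (f := fun n => ∑ _ω ∈ (Zd.sawFun 2 n 0).filter (fun ω => ∀ i ≤ n, P (ω i)),
            criticalFugacity ^ n)
          (fun n _ => Finset.sum_nonneg fun _ _ => pow_nonneg criticalFugacity_pos.le _)
          (Finset.mem_range.2 (by omega))

/-- The one-step walk `0 → e₀` is a self-avoiding walk. -/
theorem stepWalk_mem_sawFun :
    (fun i : ℕ => if i = 0 then (0 : Site 2) else Pi.single 0 1) ∈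
      Zd.sawFun 2 1 (Pi.single 0 1) := by
  refine Zd.mem_sawFun.2 ⟨if_pos rfl, fun i hi => if_neg (by omega), fun i hi => ?_, ?_⟩
  · obtain rfl : i = 0 := by omega
    rw [if_pos rfl, if_neg (by omega), Zd.zdGraph_adj_iff_sub]
    exact ⟨0, Or.inl (sub_zero _)⟩
  · intro i hi j hj hij
    simp only [Set.mem_setOf_eq] at hi hj
    rcases Nat.le_one_iff_eq_zero_or_eq_one.1 hi with rfl | rfl <;>
      rcases Nat.le_one_iff_eq_zero_or_eq_one.1 hj with rfl | rfl
    · rfl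
    · exact absurd (congrFun hij 0) (by simp)
    · exact absurd (congrFun hij 0) (by simp)
    · rfl

/-- The unit east step has mass `x_c`: a lower bound for the mass of the two-point family `{0, e₀}`. -/
theorem criticalFugacity_le_tubeMass_step :
    criticalFugacity ≤ ∑ n ∈ Finset.range (1 + 1),
      ∑ _ω ∈ (Zd.sawFun 2 n (Pi.single 0 1)).filter
        (fun ω => ∀ i ≤ n, ω i = 0 ∨ ω i = Pi.single 0 1), criticalFugacity ^ n := by
  have hmem : (fun i : ℕ => if i = 0 then (0 : Site 2) else Pi.single 0 1) ∈
      (Zd.sawFun 2 1 (Pi.single 0 1)).filter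
        (fun ω => ∀ i ≤ (1 : ℕ), ω i = 0 ∨ ω i = Pi.single 0 1) := by
    rw [Finset.mem_filter]
    refine ⟨stepWalk_mem_sawFun, fun i _ => ?_⟩
    by_cases h : i = 0
    · exact Or.inl (if_pos h)
    · exact Or.inr (if_neg h)
  calc criticalFugacity = criticalFugacity ^ 1 := (pow_one _).symm
    _ ≤ ∑ _ω ∈ (Zd.sawFun 2 1 (Pi.single 0 1)).filter
          (fun ω => ∀ i ≤ (1 : ℕ), ω i = 0 ∨ ω i = Pi.single 0 1), criticalFugacity ^ 1 :=
        Finset.single_le_sum (f := fun _ => criticalFugacity ^ 1) (fun _ _ => pow_nonneg criticalFugacity_pos.le 1)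
          hmem
    _ ≤ _ := Finset.single_le_sum
          (f := fun n => ∑ _ω ∈ (Zd.sawFun 2 n (Pi.single 0 1)).filter
            (fun ω => ∀ i ≤ n, ω i = 0 ∨ ω i = Pi.single 0 1), criticalFugacity ^ n)
          (fun n _ => Finset.sum_nonneg fun _ _ => pow_nonneg criticalFugacity_pos.le _)
          (Finset.mem_range.2 (by omega))

/-- For each coordinate direction, the swapped unit vector is a unit vector. -/
theorem swap_sub_eq_single (k : Fin 2) : ∃ k' : Fin 2, ∀ x y : Site 2,
    y - x = Pi.single k 1 → (![y 1, y 0] : Site 2) - ![x 1, x 0] = Pi.single k' 1 := by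
  have e : ∀ x y : Site 2, (![y 1, y 0] : Site 2) - ![x 1, x 0] = ![(y - x) 1, (y - x) 0] :=
    fun x y => site_ext (by simp) (by simp)
  fin_cases k
  · exact ⟨1, fun x y h => by rw [e, h]; exact site_ext (by simp) (by simp)⟩
  · exact ⟨0, fun x y h => by rw [e, h]; exact site_ext (by simp) (by simp)⟩

/-- The coordinate swap `(x, y) ↦ (y, x)` maps a confined family injectively and weight-preservingly into
the swapped family. -/
theorem tubeMass_swap_le {P P' : Site 2 → Prop} [DecidablePred P] [DecidablePred P']
    (hPP' : ∀ p, P p → P' ![p 1, p 0]) (N : ℕ) {e e' : Site 2} (he0 : e' 0 = e 1)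
    (he1 : e' 1 = e 0) :
    (∑ n ∈ Finset.range (N + 1),
        ∑ _ω ∈ (Zd.sawFun 2 n e).filter (fun ω => ∀ i ≤ n, P (ω i)), criticalFugacity ^ n) ≤
      ∑ n ∈ Finset.range (N + 1),
        ∑ _ω ∈ (Zd.sawFun 2 n e').filter (fun ω => ∀ i ≤ n, P' (ω i)), criticalFugacity ^ n := by
  have he : e' = ![e 1, e 0] := site_ext (by simp [he0]) (by simp [he1])
  subst he
  refine Finset.sum_le_sum fun n _ => ?_
  rw [Finset.sum_const, Finset.sum_const, nsmul_eq_mul, nsmul_eq_mul]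
  refine mul_le_mul_of_nonneg_right ?_ (pow_nonneg criticalFugacity_pos.le n)
  have hcard : ((Zd.sawFun 2 n e).filter (fun ω => ∀ i ≤ n, P (ω i))).card ≤
      ((Zd.sawFun 2 n ![e 1, e 0]).filter (fun ω => ∀ i ≤ n, P' (ω i))).card := by
    refine Finset.card_le_card_of_injOn
      (fun (ω : ℕ → Site 2) (i : ℕ) => (![ω i 1, ω i 0] : Site 2)) (fun ω hω => ?_) ?_
    · rw [Finset.mem_coe, Finset.mem_filter, Zd.mem_sawFun] at hω ⊢
      obtain ⟨⟨h0, hend, hadj, hinj⟩, hP⟩ := hω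
      refine ⟨⟨site_ext (by simp [h0]) (by simp [h0]), fun i hi => by simp [hend i hi],
        fun i hi => ?_, ?_⟩, fun i hi => ?_⟩
      · obtain ⟨k, hk⟩ := (Zd.zdGraph_adj_iff_sub _ _).1 (hadj i hi)
        obtain ⟨k', hk'⟩ := swap_sub_eq_single k
        rw [Zd.zdGraph_adj_iff_sub]
        exact ⟨k', hk.imp (hk' _ _) (hk' _ _)⟩
      · intro i hi j hj hij
        have h0 := congrFun hij 0
        have h1 := congrFun hij 1
        simp only [Matrix.cons_val_zero, Matrix.cons_val_one] at h0 h1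
        exact hinj hi hj (site_ext h1 h0)
      · exact hPP' _ (hP i hi)
    · intro ω _ ω' _ h
      funext i
      have h0 := congrFun (congrFun h i) 0
      have h1 := congrFun (congrFun h i) 1
      simp only [Matrix.cons_val_zero, Matrix.cons_val_one] at h0 h1
      exact site_ext h1 h0
  exact_mod_cast hcard

/-! ### Gluing: the masses of separated families multiply -/

/-- Reindexing step of the gluing inequality: if `(m, ω, n, υ) ↦ (m + n, glue m ω υ)` maps pairs of walks of
two length-graded families injectively into a third, the product of the two generating polynomials at `x_c`
is at most the third. -/
theorem sum_mul_sum_le_of_glue {F G H : ℕ → Finset (ℕ → Site 2)} {M N : ℕ}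
    (glue : ℕ → (ℕ → Site 2) → (ℕ → Site 2) → ℕ → Site 2)
    (hmaps : ∀ m ω n υ, m ≤ M → ω ∈ F m → n ≤ N → υ ∈ G n → glue m ω υ ∈ H (m + n))
    (hinj : ∀ m ω n υ m' ω' n' υ', ω ∈ F m → υ ∈ G n → ω' ∈ F m' → υ' ∈ G n' →
      m + n = m' + n' → glue m ω υ = glue m' ω' υ' → m = m' ∧ ω = ω' ∧ υ = υ') :
    (∑ m ∈ Finset.range (M + 1), ∑ _ω ∈ F m, criticalFugacity ^ m) *
        (∑ n ∈ Finset.range (N + 1), ∑ _υ ∈ G n, criticalFugacity ^ n) ≤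
      ∑ k ∈ Finset.range (M + N + 1), ∑ _γ ∈ H k, criticalFugacity ^ k := by
  set A := (Finset.range (M + 1)).sigma F with hA
  set B := (Finset.range (N + 1)).sigma G with hB
  set T := (Finset.range (M + N + 1)).sigma H with hT
  have eA : (∑ m ∈ Finset.range (M + 1), ∑ _ω ∈ F m, criticalFugacity ^ m) =
      ∑ p ∈ A, criticalFugacity ^ p.1 := Finset.sum_sigma' _ _ _
  have eB : (∑ n ∈ Finset.range (N + 1), ∑ _υ ∈ G n, criticalFugacity ^ n) =
      ∑ p ∈ B, criticalFugacity ^ p.1 := Finset.sum_sigma' _ _ _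
  have eT : (∑ k ∈ Finset.range (M + N + 1), ∑ _γ ∈ H k, criticalFugacity ^ k) =
      ∑ p ∈ T, criticalFugacity ^ p.1 := Finset.sum_sigma' _ _ _
  rw [eA, eB, eT, Finset.sum_mul_sum, ← Finset.sum_product']
  set g : (Σ _ : ℕ, (ℕ → Site 2)) × (Σ _ : ℕ, (ℕ → Site 2)) → (Σ _ : ℕ, (ℕ → Site 2)) :=
    fun z => ⟨z.1.1 + z.2.1, glue z.1.1 z.1.2 z.2.2⟩ with hg
  have hmaps' : ∀ z ∈ A ×ˢ B, g z ∈ T := by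
    rintro ⟨⟨m, ω⟩, ⟨n, υ⟩⟩ hz
    simp only [hA, hB, Finset.mem_product, Finset.mem_sigma, Finset.mem_range] at hz
    simp only [hg, hT, Finset.mem_sigma, Finset.mem_range]
    exact ⟨by omega, hmaps m ω n υ (by omega) hz.1.2 (by omega) hz.2.2⟩
  have hinj' : Set.InjOn g ↑(A ×ˢ B) := by
    rintro ⟨⟨m, ω⟩, ⟨n, υ⟩⟩ hz ⟨⟨m', ω'⟩, ⟨n', υ'⟩⟩ hz' h
    simp only [Finset.mem_coe, hA, hB, Finset.mem_product, Finset.mem_sigma,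
      Finset.mem_range] at hz hz'
    simp only [hg, Sigma.mk.inj_iff, heq_eq_eq] at h
    obtain ⟨hk, hγ⟩ := h
    obtain ⟨rfl, rfl, rfl⟩ := hinj m ω n υ m' ω' n' υ' hz.1.2 hz.2.2 hz'.1.2 hz'.2.2 hk hγ
    obtain rfl : n = n' := by omega
    rfl
  calc ∑ z ∈ A ×ˢ B, criticalFugacity ^ z.1.1 * criticalFugacity ^ z.2.1
      = ∑ z ∈ A ×ˢ B, criticalFugacity ^ (g z).1 :=
        Finset.sum_congr rfl fun z _ => by rw [hg, ← pow_add]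
    _ = ∑ w ∈ (A ×ˢ B).image g, criticalFugacity ^ w.1 :=
        (Finset.sum_image (f := fun w : Σ _ : ℕ, (ℕ → Site 2) => criticalFugacity ^ w.1) hinj').symm
    _ ≤ ∑ w ∈ T, criticalFugacity ^ w.1 :=
        Finset.sum_le_sum_of_subset_of_nonneg (Finset.image_subset_iff.2 hmaps')
          fun _ _ _ => pow_nonneg criticalFugacity_pos.le _

/-- **Gluing.**  Let `P, Q, R` confine the vertices of walks `0 → e₁`, `0 → e₂`, `0 → e = e₁ + e₂`, with
`P ⊆ R`, `e₁ + Q ⊆ R`, and suppose the region `P` meets the translate `e₁ + Q` only at points `e₁ + q` with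
`q = 0`.  Then the concatenation at `e₁` of a `P`-confined self-avoiding walk to `e₁` and the translate of a
`Q`-confined self-avoiding walk to `e₂` is self-avoiding (for free), `R`-confined, ends at `e`, and the pair is
recovered from it; hence the tube masses multiply: `mass_M(P, e₁) · mass_N(Q, e₂) ≤ mass_{M+N}(R, e)`. -/
theorem tubeMass_concat {P Q R : Site 2 → Prop} [DecidablePred P] [DecidablePred Q]
    [DecidablePred R] {e₁ e₂ e : Site 2} (he : e₁ + e₂ = e) (hP : ∀ p, P p → R p)
    (hQ : ∀ q, Q q → R (e₁ + q))
    (hsep : ∀ p q, P p → Q q → p 0 = e₁ 0 + q 0 → p 1 = e₁ 1 + q 1 → q 0 = 0 ∧ q 1 = 0)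
    (M N : ℕ) :
    (∑ m ∈ Finset.range (M + 1),
        ∑ _ω ∈ (Zd.sawFun 2 m e₁).filter (fun ω => ∀ i ≤ m, P (ω i)), criticalFugacity ^ m) *
      (∑ n ∈ Finset.range (N + 1),
        ∑ _ω ∈ (Zd.sawFun 2 n e₂).filter (fun ω => ∀ i ≤ n, Q (ω i)), criticalFugacity ^ n) ≤
      ∑ k ∈ Finset.range (M + N + 1),
        ∑ _ω ∈ (Zd.sawFun 2 k e).filter (fun ω => ∀ i ≤ k, R (ω i)), criticalFugacity ^ k := by
  subst he
  -- one concatenation is an `R`-confined self-avoiding walk to `e₁ + e₂`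
  have key : ∀ {m n : ℕ} {ω υ : ℕ → Site 2}, ω ∈ Zd.sawFun 2 m e₁ → (∀ i ≤ m, P (ω i)) →
      υ ∈ Zd.sawFun 2 n e₂ → (∀ i ≤ n, Q (υ i)) →
      Zd.concatWalk m ω υ ∈ Zd.sawFun 2 (m + n) (e₁ + e₂) ∧
        ∀ i ≤ m + n, R (Zd.concatWalk m ω υ i) := by
    intro m n ω υ hω hPω hυ hQυ
    rw [Zd.mem_sawFun_iff_mem_saws] at hω hυ
    obtain ⟨hω, hωm⟩ := hω
    obtain ⟨hυ, hυn⟩ := hυ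
    have hυ' := Zd.mem_saws.1 hυ
    refine ⟨Zd.mem_sawFun_iff_mem_saws.2 ⟨Zd.concatWalk_mem_saws hω hυ ?_, ?_⟩, ?_⟩
    · intro i hi j _ hjn heq
      have hc := hsep (ω i) (υ j) (hPω i hi) (hQυ j hjn)
        (by rw [heq, hωm, Pi.add_apply]) (by rw [heq, hωm, Pi.add_apply])
      have h0 : υ j = υ 0 := by
        rw [hυ'.1]
        exact site_ext (by rw [hc.1]; rfl) (by rw [hc.2]; rfl)
      have := hυ'.2.2.2 (show j ≤ n from hjn) (Nat.zero_le n) h0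
      omega
    · by_cases h : m + n ≤ m
      · have hn0 : n = 0 := by omega
        subst hn0
        have he2 : e₂ = 0 := by rw [← hυn, hυ'.1]
        simp only [Zd.concatWalk, if_pos (le_refl m), hωm, he2, add_zero]
      · simp only [Zd.concatWalk, if_neg h, hωm, Nat.add_sub_cancel_left, hυn]
    · intro i hi
      simp only [Zd.concatWalk]
      split_ifs with h
      · exact hP _ (hPω i h)
      · rw [hωm]
        exact hQ _ (hQυ (i - m) (by omega))
  refine sum_mul_sum_le_of_glue Zd.concatWalk ?_ ?_
  · intro m ω n υ _ hω _ hυ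
    rw [Finset.mem_filter] at hω hυ ⊢
    exact key hω.1 hω.2 hυ.1 hυ.2
  · intro m ω n υ m' ω' n' υ' hω hυ hω' hυ' hk h
    rw [Finset.mem_filter] at hω hυ hω' hυ'
    have hγ := Zd.mem_sawFun.1 (key hω.1 hω.2 hυ.1 hυ.2).1
    have h1 := Zd.mem_sawFun.1 hω.1
    have h1' := Zd.mem_sawFun.1 hω'.1
    have h2 := Zd.mem_sawFun.1 hυ.1
    have h2' := Zd.mem_sawFun.1 hυ'.1
    -- the times `m` and `m'` are both visits of `e₁`, so they coincide
    have hmm : m = m' := by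
      have hv : Zd.concatWalk m ω υ m = e₁ := by
        simp only [Zd.concatWalk, if_pos le_rfl, h1.2.1 m le_rfl]
      have hv' : Zd.concatWalk m ω υ m' = e₁ := by
        rw [h]
        simp only [Zd.concatWalk, if_pos le_rfl, h1'.2.1 m' le_rfl]
      exact hγ.2.2.2 (show m ≤ m + n by omega) (show m' ≤ m + n by omega) (hv.trans hv'.symm)
    subst hmm
    refine ⟨rfl, ?_, ?_⟩
    · funext i
      rcases le_or_gt i m with hi | hi
      · have := congrFun h i
        simpa only [Zd.concatWalk, if_pos hi] using this
      · rw [h1.2.1 i hi.le, h1'.2.1 i hi.le]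
    · funext j
      rcases Nat.eq_zero_or_pos j with rfl | hj
      · rw [h2.1, h2'.1]
      · have := congrFun h (m + j)
        simpa only [Zd.concatWalk, if_neg (by omega : ¬ m + j ≤ m), h1.2.1 m le_rfl,
          h1'.2.1 m le_rfl, Nat.add_sub_cancel_left, add_right_inj] using this

/-! ### The blocks of the staircase -/

/-- **The horizontal block.**  A one-sided flat piece of parameter `L` (a `HalfTubePieceFloor` walk
`0 → (L, 0)` inside `[0, L] × [0, L/10]`; for `L = 0` the trivial walk) followed by the unit east edge to
`(L + 1, 0)` has `x_c`-mass at least `x_c · min(c, 1) · max(1, L)^{-C}`. -/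
theorem blockH_floor {C c : ℝ} (hc : 0 < c)
    (h : ∀ L : ℕ, 1 ≤ L → ∃ N : ℕ, c * (L : ℝ) ^ (-C) ≤ ∑ n ∈ Finset.range (N + 1),
      ∑ _ω ∈ (Zd.sawFun 2 n ![(L : ℤ), 0]).filter (fun ω =>
          ∀ i ≤ n, 0 ≤ ω i 0 ∧ ω i 0 ≤ (L : ℤ) ∧ 0 ≤ ω i 1 ∧ 10 * ω i 1 ≤ (L : ℤ)),
        criticalFugacity ^ n) (L : ℕ) :
    ∃ N : ℕ, criticalFugacity * min c 1 * (max 1 (L : ℝ)) ^ (-C) ≤ ∑ n ∈ Finset.range (N + 1),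
      ∑ _ω ∈ (Zd.sawFun 2 n ![(L : ℤ) + 1, 0]).filter (fun ω => ∀ i ≤ n,
          (0 ≤ ω i 0 ∧ ω i 0 ≤ (L : ℤ) ∧ 0 ≤ ω i 1 ∧ 10 * ω i 1 ≤ (L : ℤ)) ∨
            (ω i 0 = (L : ℤ) + 1 ∧ ω i 1 = 0)),
        criticalFugacity ^ n := by
  -- the piece, uniformly in `L ≥ 0`
  obtain ⟨N, hN⟩ : ∃ N : ℕ, min c 1 * (max 1 (L : ℝ)) ^ (-C) ≤ ∑ n ∈ Finset.range (N + 1),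
      ∑ _ω ∈ (Zd.sawFun 2 n ![(L : ℤ), 0]).filter (fun ω =>
          ∀ i ≤ n, 0 ≤ ω i 0 ∧ ω i 0 ≤ (L : ℤ) ∧ 0 ≤ ω i 1 ∧ 10 * ω i 1 ≤ (L : ℤ)),
        criticalFugacity ^ n := by
    rcases Nat.eq_zero_or_pos L with rfl | hL
    · refine ⟨0, ?_⟩
      calc min c 1 * (max 1 ((0 : ℕ) : ℝ)) ^ (-C) = min c 1 := by simp
        _ ≤ 1 := min_le_right _ _
        _ ≤ _ := one_le_tubeMass_zero
            (P := fun p : Site 2 => 0 ≤ p 0 ∧ p 0 ≤ ((0 : ℕ) : ℤ) ∧ 0 ≤ p 1 ∧ 10 * p 1 ≤ ((0 : ℕ) : ℤ))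
            (by simp) (site_ext (by simp) (by simp)) 0
    · obtain ⟨N, hN⟩ := h L hL
      refine ⟨N, le_trans ?_ hN⟩
      rw [max_eq_right (by exact_mod_cast hL)]
      exact mul_le_mul_of_nonneg_right (min_le_left _ _) (Real.rpow_nonneg (Nat.cast_nonneg L) _)
  refine ⟨N + 1, ?_⟩
  have hglue := tubeMass_concat
    (P := fun p : Site 2 => 0 ≤ p 0 ∧ p 0 ≤ (L : ℤ) ∧ 0 ≤ p 1 ∧ 10 * p 1 ≤ (L : ℤ))
    (Q := fun q : Site 2 => q = 0 ∨ q = Pi.single 0 1)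
    (R := fun p : Site 2 => (0 ≤ p 0 ∧ p 0 ≤ (L : ℤ) ∧ 0 ≤ p 1 ∧ 10 * p 1 ≤ (L : ℤ)) ∨
      (p 0 = (L : ℤ) + 1 ∧ p 1 = 0))
    (e₁ := ![(L : ℤ), 0]) (e₂ := Pi.single 0 1) (e := ![(L : ℤ) + 1, 0])
    (site_ext (by simp) (by simp)) (fun p hp => Or.inl hp) ?_ ?_ N 1
  · refine le_trans ?_ hglue
    calc criticalFugacity * min c 1 * (max 1 (L : ℝ)) ^ (-C)
        = (min c 1 * (max 1 (L : ℝ)) ^ (-C)) * criticalFugacity := by ring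
      _ ≤ _ := mul_le_mul hN criticalFugacity_le_tubeMass_step criticalFugacity_pos.le
          (le_trans (by positivity) hN)
  · rintro q (rfl | rfl)
    · exact Or.inl (by simp)
    · exact Or.inr (by simp)
  · rintro p q hp (rfl | rfl) h0 _
    · exact ⟨rfl, rfl⟩
    · exfalso
      simp only [Matrix.cons_val_zero, Pi.single_eq_same] at h0
      have := hp.2.1
      omega

/-- **The vertical block**: the coordinate swap of the horizontal block — a one-sided flat piece
`0 → (0, L)` inside `[0, L/10] × [0, L]` followed by the unit north edge to `(0, L + 1)` — has `x_c`-mass at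
least `x_c · min(c, 1) · max(1, L)^{-C}`. -/
theorem blockV_floor {C c : ℝ} (hc : 0 < c)
    (h : ∀ L : ℕ, 1 ≤ L → ∃ N : ℕ, c * (L : ℝ) ^ (-C) ≤ ∑ n ∈ Finset.range (N + 1),
      ∑ _ω ∈ (Zd.sawFun 2 n ![(L : ℤ), 0]).filter (fun ω =>
          ∀ i ≤ n, 0 ≤ ω i 0 ∧ ω i 0 ≤ (L : ℤ) ∧ 0 ≤ ω i 1 ∧ 10 * ω i 1 ≤ (L : ℤ)),
        criticalFugacity ^ n) (L : ℕ) :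
    ∃ N : ℕ, criticalFugacity * min c 1 * (max 1 (L : ℝ)) ^ (-C) ≤ ∑ n ∈ Finset.range (N + 1),
      ∑ _ω ∈ (Zd.sawFun 2 n ![0, (L : ℤ) + 1]).filter (fun ω => ∀ i ≤ n,
          (0 ≤ ω i 1 ∧ ω i 1 ≤ (L : ℤ) ∧ 0 ≤ ω i 0 ∧ 10 * ω i 0 ≤ (L : ℤ)) ∨
            (ω i 1 = (L : ℤ) + 1 ∧ ω i 0 = 0)),
        criticalFugacity ^ n := by
  obtain ⟨N, hN⟩ := blockH_floor hc h L
  refine ⟨N, hN.trans (tubeMass_swap_le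
    (P := fun p : Site 2 => (0 ≤ p 0 ∧ p 0 ≤ (L : ℤ) ∧ 0 ≤ p 1 ∧ 10 * p 1 ≤ (L : ℤ)) ∨
      (p 0 = (L : ℤ) + 1 ∧ p 1 = 0))
    (P' := fun p : Site 2 => (0 ≤ p 1 ∧ p 1 ≤ (L : ℤ) ∧ 0 ≤ p 0 ∧ 10 * p 0 ≤ (L : ℤ)) ∨
      (p 1 = (L : ℤ) + 1 ∧ p 0 = 0))
    (fun p hp => by simpa using hp) N (by simp) (by simp))⟩

end CornerStaircase

/-! ### The tube test by coordinates -/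

/-- **Tube test by coordinates.**  For a lattice point `p` and a parameter `s ∈ [0, 1]`, the distance from `p`
to the segment `[0, (a, b)]` is at most `|p₀ − s a| + |p₁ − s b|` (compare with the point `s · (a, b)` of the
segment and use `‖z‖ ≤ |re z| + |im z|`). -/
theorem infDist_segment_le_coord : ∀ (a b : ℕ) (p : Site 2) (s : ℝ), 0 ≤ s → s ≤ 1 →
    Metric.infDist (Site.toComplex p)
        (segment ℝ (Site.toComplex (0 : Site 2)) (Site.toComplex (![(a : ℤ), (b : ℤ)] : Site 2))) ≤
      |((p 0 : ℤ) : ℝ) - s * a| + |((p 1 : ℤ) : ℝ) - s * b| := by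
  intro a b p s hs0 hs1
  set v : ℂ := Site.toComplex (![(a : ℤ), (b : ℤ)] : Site 2) with hv
  have h0 : Site.toComplex (0 : Site 2) = 0 := Complex.ext (by simp) (by simp)
  have hz : s • v ∈ segment ℝ (Site.toComplex (0 : Site 2)) v := by
    rw [h0]
    exact ⟨1 - s, s, by linarith, hs0, by ring, by rw [smul_zero, zero_add]⟩
  calc Metric.infDist (Site.toComplex p) (segment ℝ (Site.toComplex (0 : Site 2)) v)
      ≤ dist (Site.toComplex p) (s • v) := Metric.infDist_le_dist_of_mem hz
    _ = ‖Site.toComplex p - s • v‖ := dist_eq_norm _ _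
    _ ≤ |(Site.toComplex p - s • v).re| + |(Site.toComplex p - s • v).im| :=
        Complex.norm_le_abs_re_add_abs_im _
    _ = |((p 0 : ℤ) : ℝ) - s * a| + |((p 1 : ℤ) : ℝ) - s * b| := by
        simp [hv, Site.toComplex]

end Summit.CriticalPhenomena.SAWScalingLimit.Theorems.TubeLowerBound.LiebSimonStar

end
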